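import Summits.AtomisticToContinuum.FouriersLaw.Theorems.VanishingNoiseTransferVanishingNoiseBoundFlipTestFunctions

/-!
# End kinetic temperatures of a weak flip-steady state — no moment hypothesis
(brick for crux stmt-AtomisticToContinuum-11976 `VanishingNoiseTransfer.VanishingNoiseBound`, line
`fekete-usc-one-length`, stub S3 `stub_noisyPositiveConductance`; worker file 2/3)

For the pinned anharmonic chain `P = pinnedChain ω₂ lam β γ` (`ω₂ > 0`, `lam, β ≥ 0`, `γ > 0`) with `N ≥ 1`
sites and ANY weak steady state `μ` of the flip-noisy dynamics `L + εS` at bath temperatures `T_L, T_R` and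
rate `ε` (`OscillatorChain.IsFlipSteadyState`: probability measure, `∫ (L f + ε S f) dμ = 0` for `f ∈ C_c^∞`,
bond currents integrable — NO moment assumption), the two end momenta are square integrable and their
kinetic temperatures add up to the bath temperatures:

  `p_0², p_{N-1}² ∈ L¹(μ)` and `∫ p_0² dμ + ∫ p_{N-1}² dμ = T_L + T_R`

(`integrable_sq_momentum_left/right`, `integral_sq_momentum_ends`). At `ε = 0` this is the deterministic
weak steady state (`isFlipSteadyState_zero_iff`), so the statement also removes the exponential-moment
hypothesis from the tree's energy bookkeeping (`…PhononMeanFreePathBoundaryKuboEnergyBalance.bath_balance`).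

Proof. Test the weak equation on the truncated energy `f_R = R φ(H/R) − R φ(2) ∈ C_c^∞` of file 1/3
(flip-invariant, so the flip term drops): `L f_R = γ[(T_L+T_R) χ(H/R) − χ(H/R)(p_0² + p_{N-1}²) +
R⁻¹χ'(H/R)(T_L p_0² + T_R p_{N-1}²)]` with the last term bounded by `4‖χ'‖_∞(|T_L|+|T_R|)` and eventually
`0` pointwise. Hence `∫ χ(H/R)(p_0²+p_{N-1}²) dμ → T_L + T_R` (`R = n+1 → ∞`, dominated convergence on the two
bounded terms), Fatou's lemma gives `∫ (p_0² + p_{N-1}²) dμ ≤ T_L + T_R < ∞`, and dominated convergence then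
upgrades the limit to the identity. References: Bonetto–Lebowitz–Rey-Bellet 2000 §5.2 eq. (25)
(`μ(LH) = 0`); Bernardin–Olla 2011 §2.1 (`S H = 0`).
-/

noncomputable section

namespace Summit.AtomisticToContinuum.FouriersLaw.Theorems.VanishingNoiseBound

open MeasureTheory Filter Topology Set
open scoped ContDiff NNReal ENNReal
open Literature.MathematicalPhysics.KineticTheory
open Literature.MathematicalPhysics.KineticTheory.HeatConduction
open Summit.AtomisticToContinuum.FouriersLaw.Theorems.SubdiffusiveBondHeat
open Summit.AtomisticToContinuum.FouriersLaw.Theorems.LinearResponseFTUR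

variable {N : ℕ}

/-! ### End kinetic temperatures of a weak flip steady state of the pinned chain -/

section Pinned

variable {ω₂ lam β γ : ℝ}

/-- **Technical core.** For a weak flip steady state `μ` of the pinned chain (`ω₂ > 0`, `lam, β ≥ 0`,
`γ > 0`, `N ≥ 1`, any `T_L, T_R, ε`), the truncated end kinetic energies
`G_n = χ(H/(n+1))·(p_0² + p_{N-1}²)` are integrable and `∫ G_n dμ → T_L + T_R`: the weak equation on the
truncated energy `f_{n+1}`, whose generator is `γ[(T_L+T_R)χ − G_n + R⁻¹χ'(H/R)(T_L p_0² + T_R p_{N-1}²)]`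
with the last term bounded by `4‖χ'‖_∞(|T_L|+|T_R|)` and eventually `0` pointwise, plus dominated convergence
on the two bounded terms. [Bonetto–Lebowitz–Rey-Bellet 2000, §5.2 eq. (25)] [folklore] -/
theorem integrable_cutoff_sq_ends_and_tendsto (hω : 0 < ω₂) (hl : 0 ≤ lam) (hβ : 0 ≤ β) (hγ : 0 < γ)
    (hN : 0 < N) {T_L T_R ε : ℝ} {μ : Measure (PhaseSpace N)}
    (hμ : (pinnedChain ω₂ lam β γ).IsFlipSteadyState N T_L T_R ε μ) :
    (∀ n : ℕ, Integrable (fun x => smoothCutoff ((pinnedChain ω₂ lam β γ).hamiltonian N x / ((n : ℝ) + 1)) *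
        (x.2 ⟨0, hN⟩ ^ 2 + x.2 ⟨N - 1, Nat.sub_lt hN one_pos⟩ ^ 2)) μ) ∧
    Tendsto (fun n : ℕ => ∫ x, smoothCutoff ((pinnedChain ω₂ lam β γ).hamiltonian N x / ((n : ℝ) + 1)) *
        (x.2 ⟨0, hN⟩ ^ 2 + x.2 ⟨N - 1, Nat.sub_lt hN one_pos⟩ ^ 2) ∂μ)
      atTop (𝓝 (T_L + T_R)) := by
  set P := pinnedChain ω₂ lam β γ with hP
  haveI := hμ.isProbabilityMeasure
  have hγ' : P.γ = γ := rfl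
  have hU : ContDiff ℝ ∞ P.U := pinnedChain_contDiff_U ω₂ lam β γ
  have hV : ContDiff ℝ ∞ P.V := pinnedChain_contDiff_V ω₂ lam β γ
  have hHs : ContDiff ℝ ∞ (P.hamiltonian N) := P.contDiff_hamiltonian hU hV N
  have hH2 : ContDiff ℝ 2 (P.hamiltonian N) := hHs.of_le (by norm_cast)
  have hHd : Differentiable ℝ (P.hamiltonian N) := hH2.differentiable (by norm_num)
  have hHc : Continuous (P.hamiltonian N) := hHs.continuous
  have hconf : P.IsConfining := pinnedChain_isConfining hω hl hβ hγ.le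
  have hU0 : ∀ q, 0 ≤ P.U q := hconf.U_nonneg
  have hV0 : ∀ r, 0 ≤ P.V r := hconf.V_nonneg
  have hcpt : ∀ E : ℝ, IsCompact {x : PhaseSpace N | P.hamiltonian N x ≤ E} :=
    pinnedChain_isCompact_setOf_hamiltonian_le hω hl hβ γ N
  obtain ⟨M₁, hM₁0, hM₁⟩ := exists_bound_deriv_smoothCutoff
  set a : Fin N := ⟨0, hN⟩ with ha
  set b : Fin N := ⟨N - 1, Nat.sub_lt hN one_pos⟩ with hb
  -- the three pieces of `L f_{n+1}`
  set χf : ℕ → PhaseSpace N → ℝ := fun n x => smoothCutoff (P.hamiltonian N x / ((n : ℝ) + 1)) with hχf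
  set A : ℕ → PhaseSpace N → ℝ := fun n x => (T_L + T_R) * χf n x with hA
  set G : ℕ → PhaseSpace N → ℝ := fun n x => χf n x * (x.2 a ^ 2 + x.2 b ^ 2) with hG
  set B : ℕ → PhaseSpace N → ℝ := fun n x =>
    deriv smoothCutoff (P.hamiltonian N x / ((n : ℝ) + 1)) / ((n : ℝ) + 1) *
      (T_L * x.2 a ^ 2 + T_R * x.2 b ^ 2) with hB
  have hR : ∀ n : ℕ, (0 : ℝ) < (n : ℝ) + 1 := fun n => by positivity
  -- the weak equation on the truncated energies
  have hweak : ∀ n : ℕ, ∫ x, P.generator N T_L T_R (fun y => ((n : ℝ) + 1) * linCutoff (P.hamiltonian N y / ((n : ℝ) + 1)) -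
        ((n : ℝ) + 1) * linCutoff 2) x ∂μ = 0 := fun n =>
    integral_generator_eq_zero_of_flipInvariant hμ (contDiff_truncEnergy P hU hV N _)
      (hasCompactSupport_truncEnergy P hcpt (hR n)) (truncEnergy_momentumFlip P _)
  have hgen : ∀ (n : ℕ) (x : PhaseSpace N),
      P.generator N T_L T_R (fun y => ((n : ℝ) + 1) * linCutoff (P.hamiltonian N y / ((n : ℝ) + 1)) -
        ((n : ℝ) + 1) * linCutoff 2) x = γ * (A n x - G n x + B n x) := by
    intro n x
    rw [generator_truncEnergy P hN hHd (hR n).ne' T_L T_R x, hγ']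
  -- continuity
  have hχc : ∀ n, Continuous (χf n) := fun n => continuous_smoothCutoff.comp (hHc.div_const _)
  have hpa : Continuous fun x : PhaseSpace N => x.2 a ^ 2 := by fun_prop
  have hpb : Continuous fun x : PhaseSpace N => x.2 b ^ 2 := by fun_prop
  have hAc : ∀ n, Continuous (A n) := fun n => continuous_const.mul (hχc n)
  have hGc : ∀ n, Continuous (G n) := fun n => (hχc n).mul (hpa.add hpb)
  have hdχc : ∀ n : ℕ, Continuous fun x : PhaseSpace N =>
      deriv smoothCutoff (P.hamiltonian N x / ((n : ℝ) + 1)) := fun n =>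
    ((contDiff_smoothCutoff (n := 1)).continuous_deriv le_rfl).comp (hHc.div_const _)
  have hBc : ∀ n, Continuous (B n) := fun n =>
    ((hdχc n).div_const _).mul ((continuous_const.mul hpa).add (continuous_const.mul hpb))
  -- uniform bounds
  have hAbd : ∀ n x, |A n x| ≤ |T_L + T_R| := by
    intro n x
    simp only [hA]
    rw [abs_mul]
    exact mul_le_of_le_one_right (abs_nonneg _) (abs_smoothCutoff_le_one _)
  have hBbd : ∀ n x, |B n x| ≤ (|T_L| + |T_R|) * (4 * M₁) := by
    intro n x
    have h1 := abs_deriv_smoothCutoff_div_mul_sq_le P hU0 hV0 hM₁0 hM₁ (hR n) x a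
    have h2 := abs_deriv_smoothCutoff_div_mul_sq_le P hU0 hV0 hM₁0 hM₁ (hR n) x b
    simp only [hB]
    set d : ℝ := deriv smoothCutoff (P.hamiltonian N x / ((n : ℝ) + 1)) / ((n : ℝ) + 1) with hd
    calc |d * (T_L * x.2 a ^ 2 + T_R * x.2 b ^ 2)|
        = |T_L * (d * x.2 a ^ 2) + T_R * (d * x.2 b ^ 2)| := by ring_nf
      _ ≤ |T_L * (d * x.2 a ^ 2)| + |T_R * (d * x.2 b ^ 2)| := abs_add_le _ _
      _ = |T_L| * |d * x.2 a ^ 2| + |T_R| * |d * x.2 b ^ 2| := by congr 1 <;> exact abs_mul _ _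
      _ ≤ |T_L| * (4 * M₁) + |T_R| * (4 * M₁) :=
          add_le_add (mul_le_mul_of_nonneg_left h1 (abs_nonneg _))
            (mul_le_mul_of_nonneg_left h2 (abs_nonneg _))
      _ = (|T_L| + |T_R|) * (4 * M₁) := by ring
  have hGbd : ∀ (n : ℕ) (x : PhaseSpace N), |G n x| ≤ 8 * ((n : ℝ) + 1) := fun n x =>
    abs_smoothCutoff_mul_sq_ends_le P hU0 hV0 (hR n) x a b
  -- integrability
  have hAi : ∀ n, Integrable (A n) μ := fun n => integrable_of_continuous_of_abs_le (hAc n) (hAbd n)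
  have hBi : ∀ n, Integrable (B n) μ := fun n => integrable_of_continuous_of_abs_le (hBc n) (hBbd n)
  have hGi : ∀ n, Integrable (G n) μ := fun n => integrable_of_continuous_of_abs_le (hGc n) (hGbd n)
  -- the balance `∫ G_n = ∫ A_n + ∫ B_n`
  have hbal : ∀ n, ∫ x, G n x ∂μ = (∫ x, A n x ∂μ) + ∫ x, B n x ∂μ := by
    intro n
    have h0 := hweak n
    simp_rw [hgen n] at h0
    rw [integral_const_mul, mul_eq_zero] at h0
    rcases h0 with h0 | h0
    · exact absurd h0 hγ.ne'
    rw [integral_add ((hAi n).sub' (hGi n)) (hBi n), integral_sub (hAi n) (hGi n)] at h0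
    linarith
  -- limits of the two bounded pieces (dominated convergence)
  have hAlim : Tendsto (fun n => ∫ x, A n x ∂μ) atTop (𝓝 (T_L + T_R)) := by
    have h := tendsto_integral_of_dominated_convergence (fun _ => |T_L + T_R|)
      (fun n => (hAc n).aestronglyMeasurable) (integrable_const (μ := μ) _)
      (fun n => Eventually.of_forall fun x => by rw [Real.norm_eq_abs]; exact hAbd n x)
      (Eventually.of_forall fun x =>
        show Tendsto (fun n => A n x) atTop (𝓝 (T_L + T_R)) from
          tendsto_const_nhds.congr' ((eventually_smoothCutoff_hamiltonian_eq_one P x).mono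
            fun n hn => by simp only [hA, hχf]; rw [hn, mul_one]))
    simpa only [integral_const, probReal_univ, one_smul] using h
  have hBlim : Tendsto (fun n => ∫ x, B n x ∂μ) atTop (𝓝 0) := by
    have h := tendsto_integral_of_dominated_convergence (fun _ => (|T_L| + |T_R|) * (4 * M₁))
      (fun n => (hBc n).aestronglyMeasurable) (integrable_const (μ := μ) _)
      (fun n => Eventually.of_forall fun x => by rw [Real.norm_eq_abs]; exact hBbd n x)
      (Eventually.of_forall fun x =>
        show Tendsto (fun n => B n x) atTop (𝓝 0) from
          tendsto_const_nhds.congr' ((eventually_deriv_smoothCutoff_hamiltonian_eq_zero P x).mono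
            fun n hn => by simp only [hB]; rw [hn, zero_div, zero_mul]))
    simpa only [integral_zero] using h
  refine ⟨hGi, ?_⟩
  have e : (fun n => ∫ x, G n x ∂μ) = fun n => (∫ x, A n x ∂μ) + ∫ x, B n x ∂μ := funext hbal
  rw [e]
  simpa using hAlim.add hBlim

/-- **Square integrability of the end momenta.** For every weak flip steady state `μ` of the pinned chain
(`ω₂ > 0`, `lam, β ≥ 0`, `γ > 0`, `N ≥ 1`; any `T_L, T_R, ε` — no moment hypothesis):
`p_0² + p_{N-1}² ∈ L¹(μ)` (Fatou on the truncated balance). [folklore] -/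
theorem integrable_sq_momentum_ends (hω : 0 < ω₂) (hl : 0 ≤ lam) (hβ : 0 ≤ β) (hγ : 0 < γ)
    (hN : 0 < N) {T_L T_R ε : ℝ} {μ : Measure (PhaseSpace N)}
    (hμ : (pinnedChain ω₂ lam β γ).IsFlipSteadyState N T_L T_R ε μ) :
    Integrable (fun x : PhaseSpace N => x.2 ⟨0, hN⟩ ^ 2 + x.2 ⟨N - 1, Nat.sub_lt hN one_pos⟩ ^ 2) μ := by
  set P := pinnedChain ω₂ lam β γ with hP
  haveI := hμ.isProbabilityMeasure
  obtain ⟨hGi, hGlim⟩ := integrable_cutoff_sq_ends_and_tendsto hω hl hβ hγ hN hμ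
  set a : Fin N := ⟨0, hN⟩ with ha
  set b : Fin N := ⟨N - 1, Nat.sub_lt hN one_pos⟩ with hb
  set s : PhaseSpace N → ℝ := fun x => x.2 a ^ 2 + x.2 b ^ 2 with hs
  set G : ℕ → PhaseSpace N → ℝ := fun n x =>
    smoothCutoff (P.hamiltonian N x / ((n : ℝ) + 1)) * (x.2 a ^ 2 + x.2 b ^ 2) with hG
  have hHc : Continuous (P.hamiltonian N) := pinnedChain_continuous_hamiltonian ω₂ lam β γ N
  have hsc : Continuous s := by simp only [hs]; fun_prop
  have hs0 : ∀ x, 0 ≤ s x := fun x => by positivity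
  have hG0 : ∀ n x, 0 ≤ G n x := fun n x => mul_nonneg (smoothCutoff_nonneg _) (hs0 x)
  have hGc : ∀ n, Continuous (G n) := fun n =>
    (continuous_smoothCutoff.comp (hHc.div_const _)).mul hsc
  -- pointwise: `G_n(x) → s(x)` (eventually equal)
  have hGpt : ∀ x, Tendsto (fun n => ENNReal.ofReal (G n x)) atTop (𝓝 (ENNReal.ofReal (s x))) := by
    intro x
    refine tendsto_const_nhds.congr' ((eventually_smoothCutoff_hamiltonian_eq_one P x).mono
      fun n hn => ?_)
    simp only [hG, hs]
    rw [hn, one_mul]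
  -- Fatou
  have hF := lintegral_liminf_le' (μ := μ) (u := atTop) (f := fun n x => ENNReal.ofReal (G n x))
    (fun n => (hGc n).measurable.ennreal_ofReal.aemeasurable)
  have hlhs : ∫⁻ x, ENNReal.ofReal (s x) ∂μ = ∫⁻ x, liminf (fun n => ENNReal.ofReal (G n x)) atTop ∂μ :=
    lintegral_congr fun x => ((hGpt x).liminf_eq).symm
  have hrhs : liminf (fun n => ∫⁻ x, ENNReal.ofReal (G n x) ∂μ) atTop = ENNReal.ofReal (T_L + T_R) := by
    refine Tendsto.liminf_eq ?_
    have e : (fun n => ∫⁻ x, ENNReal.ofReal (G n x) ∂μ) = fun n => ENNReal.ofReal (∫ x, G n x ∂μ) :=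
      funext fun n => (ofReal_integral_eq_lintegral_ofReal (hGi n) (Eventually.of_forall (hG0 n))).symm
    rw [e]
    exact ENNReal.tendsto_ofReal hGlim
  have hfin : ∫⁻ x, ENNReal.ofReal (s x) ∂μ < (⊤ : ℝ≥0∞) := by
    rw [hlhs]
    exact lt_of_le_of_lt (hF.trans_eq hrhs) ENNReal.ofReal_lt_top
  exact ⟨hsc.aestronglyMeasurable, (hasFiniteIntegral_iff_ofReal (Eventually.of_forall hs0)).2 hfin⟩

/-- `p_0² ∈ L¹(μ)` for every weak flip steady state of the pinned chain (`N ≥ 1`). [folklore] -/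
theorem integrable_sq_momentum_left (hω : 0 < ω₂) (hl : 0 ≤ lam) (hβ : 0 ≤ β) (hγ : 0 < γ)
    (hN : 0 < N) {T_L T_R ε : ℝ} {μ : Measure (PhaseSpace N)}
    (hμ : (pinnedChain ω₂ lam β γ).IsFlipSteadyState N T_L T_R ε μ) :
    Integrable (fun x : PhaseSpace N => x.2 ⟨0, hN⟩ ^ 2) μ := by
  refine (integrable_sq_momentum_ends hω hl hβ hγ hN hμ).mono'
    (by fun_prop : Continuous fun x : PhaseSpace N => x.2 ⟨0, hN⟩ ^ 2).aestronglyMeasurable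
    (Eventually.of_forall fun x => ?_)
  rw [Real.norm_eq_abs, abs_of_nonneg (sq_nonneg _)]
  nlinarith [sq_nonneg (x.2 ⟨N - 1, Nat.sub_lt hN one_pos⟩)]

/-- `p_{N-1}² ∈ L¹(μ)` for every weak flip steady state of the pinned chain (`N ≥ 1`). [folklore] -/
theorem integrable_sq_momentum_right (hω : 0 < ω₂) (hl : 0 ≤ lam) (hβ : 0 ≤ β) (hγ : 0 < γ)
    (hN : 0 < N) {T_L T_R ε : ℝ} {μ : Measure (PhaseSpace N)}
    (hμ : (pinnedChain ω₂ lam β γ).IsFlipSteadyState N T_L T_R ε μ) :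
    Integrable (fun x : PhaseSpace N => x.2 ⟨N - 1, Nat.sub_lt hN one_pos⟩ ^ 2) μ := by
  refine (integrable_sq_momentum_ends hω hl hβ hγ hN hμ).mono'
    (by fun_prop : Continuous fun x : PhaseSpace N =>
      x.2 ⟨N - 1, Nat.sub_lt hN one_pos⟩ ^ 2).aestronglyMeasurable
    (Eventually.of_forall fun x => ?_)
  rw [Real.norm_eq_abs, abs_of_nonneg (sq_nonneg _)]
  nlinarith [sq_nonneg (x.2 ⟨0, hN⟩)]

/-- **End kinetic temperatures add up to the bath temperatures.** For every weak flip steady state `μ` of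
the pinned chain (`ω₂ > 0`, `lam, β ≥ 0`, `γ > 0`, `N ≥ 1`; any `T_L, T_R`, any rate `ε`, no moment
hypothesis): `∫ p_0² dμ + ∫ p_{N-1}² dμ = T_L + T_R` — the energy injected by one bath leaves through the
other (`μ(LH) = 0`; for `N = 1` both baths act on `p_0` and the identity reads `2∫p_0² = T_L + T_R`).
[Bonetto–Lebowitz–Rey-Bellet 2000, §5.2 eq. (25)] [folklore] -/
theorem integral_sq_momentum_ends (hω : 0 < ω₂) (hl : 0 ≤ lam) (hβ : 0 ≤ β) (hγ : 0 < γ)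
    (hN : 0 < N) {T_L T_R ε : ℝ} {μ : Measure (PhaseSpace N)}
    (hμ : (pinnedChain ω₂ lam β γ).IsFlipSteadyState N T_L T_R ε μ) :
    (∫ x, x.2 ⟨0, hN⟩ ^ 2 ∂μ) + ∫ x, x.2 ⟨N - 1, Nat.sub_lt hN one_pos⟩ ^ 2 ∂μ = T_L + T_R := by
  set P := pinnedChain ω₂ lam β γ with hP
  haveI := hμ.isProbabilityMeasure
  obtain ⟨-, hGlim⟩ := integrable_cutoff_sq_ends_and_tendsto hω hl hβ hγ hN hμ
  have hint := integrable_sq_momentum_ends hω hl hβ hγ hN hμ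
  set a : Fin N := ⟨0, hN⟩ with ha
  set b : Fin N := ⟨N - 1, Nat.sub_lt hN one_pos⟩ with hb
  have hHc : Continuous (P.hamiltonian N) := pinnedChain_continuous_hamiltonian ω₂ lam β γ N
  have hGc : ∀ n : ℕ, Continuous fun x : PhaseSpace N =>
      smoothCutoff (P.hamiltonian N x / ((n : ℝ) + 1)) * (x.2 a ^ 2 + x.2 b ^ 2) := fun n =>
    (continuous_smoothCutoff.comp (hHc.div_const ((n : ℝ) + 1))).mul (by fun_prop)
  -- dominated convergence with the integrable bound `p_0² + p_{N-1}²`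
  have hlim := tendsto_integral_of_dominated_convergence
    (F := fun (n : ℕ) (x : PhaseSpace N) =>
      smoothCutoff (P.hamiltonian N x / ((n : ℝ) + 1)) * (x.2 a ^ 2 + x.2 b ^ 2))
    (fun x : PhaseSpace N => x.2 a ^ 2 + x.2 b ^ 2)
    (fun n => (hGc n).aestronglyMeasurable) hint
    (fun n => Eventually.of_forall fun x => by
      rw [Real.norm_eq_abs, abs_of_nonneg (mul_nonneg (smoothCutoff_nonneg _) (by positivity))]
      exact mul_le_of_le_one_left (by positivity) (smoothCutoff_le_one _))
    (Eventually.of_forall fun x =>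
      show Tendsto (fun n : ℕ => smoothCutoff (P.hamiltonian N x / ((n : ℝ) + 1)) *
          (x.2 a ^ 2 + x.2 b ^ 2)) atTop (𝓝 (x.2 a ^ 2 + x.2 b ^ 2)) from
        tendsto_const_nhds.congr' ((eventually_smoothCutoff_hamiltonian_eq_one P x).mono
          fun n hn => by simp only [hn, one_mul]))
  have h := tendsto_nhds_unique hGlim hlim
  rw [integral_add (integrable_sq_momentum_left hω hl hβ hγ hN hμ)
    (integrable_sq_momentum_right hω hl hβ hγ hN hμ)] at h
  exact h.symm

/-- **Registered sub-goal `stubS3_flipEndTemperatures`** (brick for stub S3 `stub_noisyPositiveConductance` of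
crux stmt-AtomisticToContinuum-11976): for every weak flip steady state of the pinned chain (`ω₂ > 0`,
`lam, β ≥ 0`, `γ > 0`, `N ≥ 1`, any `T_L, T_R, ε`, NO moment hypothesis) the end momenta are square
integrable and `∫ p_0² dμ + ∫ p_{N-1}² dμ = T_L + T_R`.
[Bonetto–Lebowitz–Rey-Bellet 2000, §5.2 eq. (25)] [folklore] -/
theorem stubS3_flipEndTemperatures :
    ∀ ω₂ lam β γ : ℝ, 0 < ω₂ → 0 ≤ lam → 0 ≤ β → 0 < γ →
      ∀ (N : ℕ) (hN : 0 < N) (T_L T_R ε : ℝ) (μ : Measure (PhaseSpace N)),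
        (pinnedChain ω₂ lam β γ).IsFlipSteadyState N T_L T_R ε μ →
          Integrable (fun x : PhaseSpace N => x.2 ⟨0, hN⟩ ^ 2) μ ∧
            Integrable (fun x : PhaseSpace N => x.2 ⟨N - 1, Nat.sub_lt hN one_pos⟩ ^ 2) μ ∧
              (∫ x, x.2 ⟨0, hN⟩ ^ 2 ∂μ) + ∫ x, x.2 ⟨N - 1, Nat.sub_lt hN one_pos⟩ ^ 2 ∂μ = T_L + T_R :=
  fun _ _ _ _ hω hl hβ hγ _ hN _ _ _ _ hμ =>
    ⟨integrable_sq_momentum_left hω hl hβ hγ hN hμ, integrable_sq_momentum_right hω hl hβ hγ hN hμ,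
      integral_sq_momentum_ends hω hl hβ hγ hN hμ⟩

end Pinned

end Summit.AtomisticToContinuum.FouriersLaw.Theorems.VanishingNoiseBound

end
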